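import Summits.QuantumFields.YangMills.Theorems.F4SubCurvatureDoorShortRootRigiditySliceInClass
import Mathlib
import HarnessLib

/-!
# Registered stub (A) «ANGULAR CONTINUATION» of LINE g20-A «angular type» (crux ⟨stmt-QuantumFields-23035⟩
# `F4SubCurvatureDoor.ShortRootRigidity`): the spectral-cone charts glue to an entire `π/3`-periodic function of little-o type `6`

Free-hands work of width seat `ym-line-sfw-p2-w3` (g37, cell `ym-idea-1`).  One-variable complex analysis, Mathlib only.
Given the frame-`e₀` SPECTRAL CONE data of (C) — for every `ε > 0` a function `F_ε` holomorphic on the forward tube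
`{|Im β| < Re ζ}` with real trace `F_ε(t, b) = k(ε + t, b)` and majorant `‖F_ε(ζ, β)‖ ≤ k(ε + Re ζ − |Im β|, 0)` — and the
hexagonal symmetry of the planar class:

* CHARTS: `θ ↦ F_ε(r cos(θ − jπ/3) − ε, r sin(θ − jπ/3))` lands in the tube as soon as `ε < r cos(Re θ − jπ/3) e^{−|Im θ|}`
  (`cosh ψ − |sinh ψ| = e^{−|ψ|}`);
* `ε`-CONSISTENCY `F_ε(ζ, β) = F_{ε'}(ζ + ε − ε', β)` on the tube (two one-variable identity theorems: a half-plane in `ζ`, a strip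
  in `β`), so the chart value does not depend on `ε` and NO connectedness of the lens-shaped chart domains is needed;
* per direction `j ∈ ℤ` the chart function `G_j` (with `ε(θ) = (r/4)e^{−|Im θ|}`) is holomorphic on the strip `|Re θ − jπ/3| < π/3`;
  `D₆ ∋` rotation by `π/3` (`polar r (φ − π/3) = −θ_hex(θ₂(polar r φ))`) makes every `G_j` restrict to `φ ↦ k(polar r φ)` on the
  reals, hence the `G_j` agree on the (convex) strip overlaps and glue to an ENTIRE `G`, `π/3`-periodic by the identity theorem;
* GROWTH: the majorant reads `k(r cos(a) e^{−|ψ|}, 0)` with `cos a ≥ 1/2`, and the class budget `‖y‖⁶ k(y) → 0` gives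
  `‖G(φ + iψ)‖ ≤ δ e^{6|ψ|}` for `|ψ| ≥ Ψ(δ)`.

The Props `mk2`, `polar`, `fwdTube`, `PlanarSpectralCone`, `AngularContinuation` are restated CHARACTER-FOR-CHARACTER from the
registered skeleton `Cruxes/ShortRootRigidity/Lines/angular_type.lean` (same namespace, as for ✓`stub_periodicEntireRigidity`), so
`stub_angularContinuation` closes stub (A) BY NAME.  HONEST LABEL: the M stub of a PASSed line; the load-bearing stub (C)
`PlanarSpectralCone` (XL) is untouched; no crux, rung, leaf or summit is proved; the Yang–Mills mass gap is NOT proved by this.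
-/

noncomputable section

namespace Summit.QuantumFields.YangMills.Cruxes.ShortRootRigidity.AngularType

open Complex Filter Set Metric Function
open scoped Topology Real
open Literature.MathematicalPhysics.QuantumLattice (timeReflection timeReflection_apply)
open Summit.QuantumFields.YangMills.Theorems.F4SubCurvatureDoorSliceDensityRegistered (E2)
open Summit.QuantumFields.YangMills.Theorems.F4SubCurvatureDoorSliceInClassRegistered (hexReflection InPlanarClass)

/-! ## The registered texts (verbatim from the skeleton) -/

/-- The point `(a, b)` of the plane. [problem-side definition] -/
def mk2 (a b : ℝ) : E2 := (WithLp.equiv 2 (Fin 2 → ℝ)).symm ![a, b]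

/-- Polar coordinates `(r cos φ, r sin φ)`. [problem-side definition] -/
def polar (r φ : ℝ) : E2 := mk2 (r * Real.cos φ) (r * Real.sin φ)

/-- The forward tube of a frame: `{(ζ, β) ∈ ℂ² : |Im β| < Re ζ}`. [problem-side definition] -/
def fwdTube : Set (ℂ × ℂ) := {w | |w.2.im| < w.1.re}

/-- «PLANAR SPECTRAL CONE» for one planar kernel (frame `e₀`; the other two frames follow by `D₆`): for every `ε > 0` the shifted
axis restriction `(t, b) ↦ k(ε + t, b)` is the real trace of a function holomorphic on the forward tube and bounded there by
`k(ε + Re ζ − |Im β|, 0)` — equivalently, the Laplace–Fourier measure of the frame is carried by the forward light cone `{E ≥ |p|}`.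
BUDGET-FREE.  (Verbatim the skeleton's `PlanarSpectralCone`; stored under the name `PlanarSpectralConeFrame` because the short name
`PlanarSpectralCone` is owned by route items of `IsotropyFromPowerCounting` / `MirrorModularBoosts`; the stub file re-opens it under the
skeleton's name.) [problem-side definition] -/
def PlanarSpectralConeFrame (k : E2 → ℝ) : Prop :=
  ∀ ε : ℝ, 0 < ε → ∃ F : ℂ × ℂ → ℂ, DifferentiableOn ℂ F fwdTube ∧
    (∀ t b : ℝ, 0 < t → F ((t : ℂ), (b : ℂ)) = k (mk2 (ε + t) b)) ∧
    ∀ w ∈ fwdTube, ‖F w‖ ≤ k (mk2 (ε + (w.1.re - |w.2.im|)) 0)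

/-- «ANGULAR CONTINUATION OF TYPE SIX» for one planar kernel: on every circle the angular trace is the restriction of an entire,
`π/3`-periodic function of little-o exponential type `6`. [problem-side definition] -/
def AngularContinuation (k : E2 → ℝ) : Prop :=
  ∀ r : ℝ, 0 < r → ∃ G : ℂ → ℂ, Differentiable ℂ G ∧
    (∀ φ : ℝ, G φ = k (polar r φ)) ∧
    (∀ z : ℂ, G (z + ((Real.pi / 3 : ℝ) : ℂ)) = G z) ∧
    ∀ δ : ℝ, 0 < δ → ∃ Ψ : ℝ, ∀ φ ψ : ℝ, Ψ ≤ |ψ| → ‖G (φ + ψ * Complex.I)‖ ≤ δ * Real.exp (6 * |ψ|)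

namespace AngularChartA

/-! ## Planar coordinates and the hexagonal rotation -/

/-- First coordinate of `mk2 a b`. -/
@[simp] theorem mk2_zero (a b : ℝ) : mk2 a b 0 = a := by simp [mk2]
/-- Second coordinate of `mk2 a b`. -/
@[simp] theorem mk2_one (a b : ℝ) : mk2 a b 1 = b := by simp [mk2]

/-- Extensionality for `mk2`. -/
theorem mk2_eq_iff (a b : ℝ) (y : E2) : mk2 a b = y ↔ a = y 0 ∧ b = y 1 := by
  constructor
  · rintro rfl; simp
  · rintro ⟨ha, hb⟩; ext i; fin_cases i <;> simp [ha, hb]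

/-- `‖(s, 0)‖ = |s|`. -/
theorem norm_mk2_zero (s : ℝ) : ‖mk2 s 0‖ = |s| := by
  rw [EuclideanSpace.norm_eq, Fin.sum_univ_two, mk2_zero, mk2_one]
  simp [Real.sqrt_sq_eq_abs]

/-- `(s, 0) ≠ 0` for `s ≠ 0`. -/
theorem mk2_ne_zero {s : ℝ} (hs : s ≠ 0) : mk2 s 0 ≠ 0 := by
  intro h
  have := congrArg (fun y : E2 => y 0) h
  simp at this
  exact hs this

/-- The `D₆` identity `polar r (φ − π/3) = −θ_hex(θ₂(polar r φ))`. -/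
theorem polar_sub_pi_div_three (r φ : ℝ) :
    polar r (φ - π / 3) = -(hexReflection (timeReflection 2 (polar r φ))) := by
  ext i
  fin_cases i <;>
    simp [polar, mk2, hexReflection, timeReflection_apply, Real.cos_sub, Real.sin_sub, Real.cos_pi_div_three,
      Real.sin_pi_div_three] <;> ring

/-- Rotation by `−π/3` inside the planar class: `k(polar r (φ − π/3)) = k(polar r φ)`. -/
theorem InPlanarClass.polar_sub {k : E2 → ℝ} (hk : InPlanarClass k) (r φ : ℝ) :
    k (polar r (φ - π / 3)) = k (polar r φ) := by
  obtain ⟨-, -, hT, hH, hneg, -, -⟩ := hk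
  rw [polar_sub_pi_div_three, hneg, hH, hT]

/-- Rotation by `+π/3` inside the planar class. -/
theorem InPlanarClass.polar_add {k : E2 → ℝ} (hk : InPlanarClass k) (r φ : ℝ) :
    k (polar r (φ + π / 3)) = k (polar r φ) := by
  have h := InPlanarClass.polar_sub hk r (φ + π / 3)
  rw [add_sub_cancel_right] at h
  exact h.symm

/-- Rotations by all multiples of `π/3`: `k(polar r (φ − jπ/3)) = k(polar r φ)`, `j ∈ ℤ`. -/
theorem InPlanarClass.polar_sub_int {k : E2 → ℝ} (hk : InPlanarClass k) (r φ : ℝ) (j : ℤ) :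
    k (polar r (φ - j * (π / 3))) = k (polar r φ) := by
  induction j using Int.induction_on generalizing φ with
  | zero => simp
  | succ n ih =>
    have e : φ - ((n : ℤ) + 1 : ℤ) * (π / 3) = (φ - (n : ℤ) * (π / 3)) - π / 3 := by push_cast; ring
    rw [e, InPlanarClass.polar_sub hk, ih]
  | pred n ih =>
    have e : φ - (-(n : ℤ) - 1 : ℤ) * (π / 3) = (φ - (-(n : ℤ) : ℤ) * (π / 3)) + π / 3 := by push_cast; ring
    rw [e, InPlanarClass.polar_add hk, ih]

/-! ## Trigonometry of a complex angle -/

/-- Real part minus modulus of imaginary part at the chart point: `Re(r cos w − ε) − |Im(r sin w)| = r cos(Re w) e^{−|Im w|} − ε`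
(for `r cos(Re w) ≥ 0`; uses `Re cos(α+iψ) = cos α cosh ψ`, `Im sin(α+iψ) = cos α sinh ψ`, `cosh ψ − |sinh ψ| = e^{−|ψ|}`, whose
proofs are inlined — the named versions live in `PencilRigidityShellRigidityAngleBandLimitChart`). -/
theorem chart_re_sub_abs_im {r ε : ℝ} (w : ℂ) (hrc : 0 ≤ r * Real.cos w.re) :
    ((r : ℂ) * Complex.cos w - ε).re - |((r : ℂ) * Complex.sin w).im| =
      r * Real.cos w.re * Real.exp (-|w.im|) - ε := by
  have hre : (Complex.cos w).re = Real.cos w.re * Real.cosh w.im := by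
    rw [Complex.cos_eq]
    simp [Complex.cos_ofReal_re, Complex.cosh_ofReal_re, Complex.cos_ofReal_im,
      Complex.cosh_ofReal_im, Complex.sin_ofReal_im, Complex.sinh_ofReal_im]
  have him : (Complex.sin w).im = Real.cos w.re * Real.sinh w.im := by
    rw [Complex.sin_eq]
    simp [Complex.cos_ofReal_re, Complex.sinh_ofReal_re, Complex.cos_ofReal_im,
      Complex.sinh_ofReal_im, Complex.sin_ofReal_im, Complex.cosh_ofReal_im]
  have hcs : Real.cosh w.im - |Real.sinh w.im| = Real.exp (-|w.im|) := by
    rcases le_or_gt 0 w.im with h | h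
    · rw [abs_of_nonneg (Real.sinh_nonneg_iff.2 h), abs_of_nonneg h, Real.cosh_sub_sinh]
    · rw [abs_of_neg (Real.sinh_neg_iff.2 h), abs_of_neg h, sub_neg_eq_add, neg_neg, Real.cosh_add_sinh]
  have h1 : ((r : ℂ) * Complex.cos w - ε).re = r * (Real.cos w.re * Real.cosh w.im) - ε := by
    simp [Complex.mul_re, hre]
  have h2 : ((r : ℂ) * Complex.sin w).im = r * Real.cos w.re * Real.sinh w.im := by
    simp [Complex.mul_im, him]; ring
  rw [h1, h2, abs_mul, abs_of_nonneg hrc, ← hcs]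
  ring

/-- The chart point lies in the forward tube as soon as `ε < r cos(Re w) e^{−|Im w|}`. -/
theorem chart_mem_fwdTube {r ε : ℝ} (w : ℂ) (hrc : 0 ≤ r * Real.cos w.re)
    (hε : ε < r * Real.cos w.re * Real.exp (-|w.im|)) :
    ((r : ℂ) * Complex.cos w - ε, (r : ℂ) * Complex.sin w) ∈ fwdTube := by
  show |((r : ℂ) * Complex.sin w).im| < ((r : ℂ) * Complex.cos w - ε).re
  have := chart_re_sub_abs_im w hrc (ε := ε)
  linarith

/-! ## The one-variable identity theorem from the reals -/

/-- Two functions holomorphic on an open preconnected `U ⊆ ℂ` that agree at the real points of `U`, one of which exists, agree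
on `U`. -/
theorem eqOn_of_eq_on_real {U : Set ℂ} (hU : IsOpen U) (hUc : IsPreconnected U) {f g : ℂ → ℂ}
    (hf : DifferentiableOn ℂ f U) (hg : DifferentiableOn ℂ g U) {x₀ : ℝ} (hx₀ : (x₀ : ℂ) ∈ U)
    (h : ∀ t : ℝ, (t : ℂ) ∈ U → f t = g t) : EqOn f g U := by
  refine (hf.analyticOnNhd hU).eqOn_of_preconnected_of_frequently_eq (hg.analyticOnNhd hU) hUc hx₀ ?_
  rw [Filter.frequently_iff]
  intro V hV
  obtain ⟨δ, hδ, hball⟩ := Metric.mem_nhdsWithin_iff.1 hV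
  obtain ⟨δ', hδ', hball'⟩ := Metric.isOpen_iff.1 hU _ hx₀
  set s : ℝ := min δ δ' / 2 with hs
  have hs0 : 0 < s := by positivity
  have hsδ : s < δ := by
    have : min δ δ' ≤ δ := min_le_left _ _
    rw [hs]; linarith
  have hsδ' : s < δ' := by
    have : min δ δ' ≤ δ' := min_le_right _ _
    rw [hs]; linarith
  have hdist : dist ((x₀ + s : ℝ) : ℂ) (x₀ : ℂ) = s := by
    rw [dist_eq_norm, show ((x₀ + s : ℝ) : ℂ) - (x₀ : ℂ) = ((s : ℝ) : ℂ) by push_cast; ring, Complex.norm_real,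
      Real.norm_eq_abs, abs_of_pos hs0]
  refine ⟨((x₀ + s : ℝ) : ℂ), hball ⟨?_, ?_⟩, h _ (hball' ?_)⟩
  · rw [Metric.mem_ball, hdist]; exact hsδ
  · simp only [mem_compl_iff, mem_singleton_iff]
    intro heq
    have := congrArg Complex.re heq
    simp only [Complex.ofReal_re] at this
    linarith
  · rw [Metric.mem_ball, hdist]; exact hsδ'

/-- The open right half-plane is preconnected. -/
theorem isPreconnected_halfPlane (c : ℝ) : IsPreconnected {ζ : ℂ | c < ζ.re} :=
  (convex_halfSpace_gt Complex.reLm.isLinear c).isPreconnected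

/-- An open horizontal strip is preconnected. -/
theorem isPreconnected_strip (c : ℝ) : IsPreconnected {β : ℂ | |β.im| < c} := by
  have : {β : ℂ | |β.im| < c} = {β : ℂ | β.im < c} ∩ {β : ℂ | -c < β.im} := by
    ext β; simp only [mem_setOf_eq, mem_inter_iff, abs_lt]; tauto
  rw [this]
  exact ((convex_halfSpace_lt Complex.imLm.isLinear c).inter (convex_halfSpace_gt Complex.imLm.isLinear (-c))).isPreconnected

/-- An open vertical strip is preconnected. -/
theorem isPreconnected_vstrip (c₁ c₂ : ℝ) : IsPreconnected {θ : ℂ | c₁ < θ.re ∧ θ.re < c₂} :=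
  ((convex_halfSpace_gt Complex.reLm.isLinear c₁).inter (convex_halfSpace_lt Complex.reLm.isLinear c₂)).isPreconnected

/-- The forward tube is open. -/
theorem isOpen_fwdTube : IsOpen fwdTube :=
  isOpen_lt (continuous_abs.comp (Complex.continuous_im.comp continuous_snd)) (Complex.continuous_re.comp continuous_fst)

/-! ## `ε`-consistency of the cone charts -/

/-- **`ε`-consistency.**  Two cone charts `F`, `F'` at shifts `ε' ≤ ε` are related by `F(ζ, β) = F'(ζ + ε − ε', β)` on the whole
forward tube (identity theorem in `ζ` on the right half-plane for real `β`, then in `β` on the strip `|Im β| < Re ζ`). -/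
theorem cone_chart_shift {k : E2 → ℝ} {ε ε' : ℝ} (hle : ε' ≤ ε) {F F' : ℂ × ℂ → ℂ}
    (hF : DifferentiableOn ℂ F fwdTube) (hFr : ∀ t b : ℝ, 0 < t → F ((t : ℂ), (b : ℂ)) = k (mk2 (ε + t) b))
    (hF' : DifferentiableOn ℂ F' fwdTube) (hF'r : ∀ t b : ℝ, 0 < t → F' ((t : ℂ), (b : ℂ)) = k (mk2 (ε' + t) b))
    {w : ℂ × ℂ} (hw : w ∈ fwdTube) : F w = F' (w.1 + ((ε - ε' : ℝ) : ℂ), w.2) := by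
  -- step (i): real second variable
  have step1 : ∀ b : ℝ, EqOn (fun ζ => F (ζ, (b : ℂ))) (fun ζ => F' (ζ + ((ε - ε' : ℝ) : ℂ), (b : ℂ)))
      {ζ : ℂ | 0 < ζ.re} := by
    intro b
    have hopen : IsOpen {ζ : ℂ | 0 < ζ.re} := isOpen_lt continuous_const Complex.continuous_re
    refine eqOn_of_eq_on_real hopen (isPreconnected_halfPlane 0) ?_ ?_ (x₀ := 1) (by simp) ?_
    · refine hF.comp (by fun_prop) fun ζ hζ => ?_
      show |((b : ℂ)).im| < ζ.re
      simpa using hζ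
    · refine hF'.comp (by fun_prop) fun ζ hζ => ?_
      show |((b : ℂ)).im| < (ζ + ((ε - ε' : ℝ) : ℂ)).re
      simp only [Complex.ofReal_im, abs_zero, Complex.add_re, Complex.ofReal_re]
      have : (0 : ℝ) < ζ.re := hζ
      linarith
    · intro t ht
      have ht0 : 0 < t := by simpa using ht
      rw [hFr t b ht0, show (t : ℂ) + ((ε - ε' : ℝ) : ℂ) = ((t + (ε - ε') : ℝ) : ℂ) by push_cast; ring,
        hF'r _ b (by linarith)]
      congr 1; ring_nf
  -- step (ii): the strip in the second variable
  obtain ⟨ζ, β⟩ := w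
  have hζ : |β.im| < ζ.re := hw
  have hζ0 : 0 < ζ.re := lt_of_le_of_lt (abs_nonneg _) hζ
  have step2 : EqOn (fun β' => F (ζ, β')) (fun β' => F' (ζ + ((ε - ε' : ℝ) : ℂ), β')) {β' : ℂ | |β'.im| < ζ.re} := by
    have hopen : IsOpen {β' : ℂ | |β'.im| < ζ.re} :=
      isOpen_lt (continuous_abs.comp Complex.continuous_im) continuous_const
    refine eqOn_of_eq_on_real hopen (isPreconnected_strip ζ.re) ?_ ?_ (x₀ := 0) (by simpa using hζ0) ?_
    · exact hF.comp (by fun_prop) fun β' hβ' => hβ'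
    · refine hF'.comp (by fun_prop) fun β' hβ' => ?_
      show |β'.im| < (ζ + ((ε - ε' : ℝ) : ℂ)).re
      simp only [Complex.add_re, Complex.ofReal_re]
      have : |β'.im| < ζ.re := hβ'
      linarith
    · intro b _
      exact step1 b hζ0
  exact step2 hζ


/-! ## Strips, chart points and the shift -/

/-- The vertical strip of direction `j`: `|Re θ − jπ/3| < π/3`. -/
def strip (j : ℤ) : Set ℂ := {θ : ℂ | |θ.re - j * (π / 3)| < π / 3}

/-- Membership in the strip of direction `j`. -/
theorem mem_strip {j : ℤ} {θ : ℂ} : θ ∈ strip j ↔ |θ.re - j * (π / 3)| < π / 3 := Iff.rfl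

/-- Strips are open. -/
theorem isOpen_strip (j : ℤ) : IsOpen (strip j) :=
  isOpen_lt (continuous_abs.comp (Complex.continuous_re.sub continuous_const)) continuous_const

/-- A strip is the intersection of two open half-planes. -/
theorem strip_eq (j : ℤ) : strip j = {θ : ℂ | j * (π / 3) - π / 3 < θ.re} ∩ {θ : ℂ | θ.re < j * (π / 3) + π / 3} := by
  ext θ
  simp only [mem_strip, mem_inter_iff, mem_setOf_eq, abs_sub_lt_iff]
  constructor
  · rintro ⟨h1, h2⟩; constructor <;> linarith
  · rintro ⟨h1, h2⟩; constructor <;> linarith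

/-- Strips are convex. -/
theorem convex_strip (j : ℤ) : Convex ℝ (strip j) := by
  rw [strip_eq]
  exact (convex_halfSpace_gt Complex.reLm.isLinear _).inter (convex_halfSpace_lt Complex.reLm.isLinear _)

/-- On the strip of direction `j`, `cos(Re θ − jπ/3) > 1/2`. -/
theorem half_lt_cos_of_mem_strip {j : ℤ} {θ : ℂ} (hθ : θ ∈ strip j) : 1 / 2 < Real.cos (θ.re - j * (π / 3)) := by
  rw [← Real.cos_abs, ← Real.cos_pi_div_three]
  exact Real.cos_lt_cos_of_nonneg_of_le_pi (abs_nonneg _) (by linarith [Real.pi_pos]) (mem_strip.1 hθ)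

/-- Every `θ` lies in the strip of its nearest direction `round(Re θ/(π/3))`. -/
theorem mem_strip_round (θ : ℂ) : θ ∈ strip (round (θ.re / (π / 3))) := by
  rw [mem_strip]
  have h := abs_sub_round (θ.re / (π / 3))
  have hπ : 0 < π / 3 := by positivity
  have : θ.re - (round (θ.re / (π / 3)) : ℤ) * (π / 3) = (θ.re / (π / 3) - round (θ.re / (π / 3))) * (π / 3) := by
    field_simp
  rw [this, abs_mul, abs_of_pos hπ]
  nlinarith

/-- Membership in a strip only depends on the real part. -/
theorem ofReal_re_mem_strip {j : ℤ} {θ : ℂ} (hθ : θ ∈ strip j) : ((θ.re : ℝ) : ℂ) ∈ strip j := by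
  rw [mem_strip] at hθ ⊢; simpa using hθ

/-- The chart point of direction `j` at shift `ε`: `(r cos(θ − jπ/3) − ε, r sin(θ − jπ/3))`. -/
def chartPt (r : ℝ) (j : ℤ) (ε : ℝ) (θ : ℂ) : ℂ × ℂ :=
  ((r : ℂ) * Complex.cos (θ - (((j : ℝ) * (π / 3) : ℝ) : ℂ)) - ε, (r : ℂ) * Complex.sin (θ - (((j : ℝ) * (π / 3) : ℝ) : ℂ)))

/-- The chart point depends holomorphically on the angle. -/
theorem differentiable_chartPt (r : ℝ) (j : ℤ) (ε : ℝ) : Differentiable ℂ (chartPt r j ε) := by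
  unfold chartPt; fun_prop

/-- Real part of the shifted angle. -/
theorem re_angle (j : ℤ) (θ : ℂ) : (θ - (((j : ℝ) * (π / 3) : ℝ) : ℂ)).re = θ.re - j * (π / 3) := by simp

/-- Imaginary part of the shifted angle. -/
theorem im_angle (j : ℤ) (θ : ℂ) : (θ - (((j : ℝ) * (π / 3) : ℝ) : ℂ)).im = θ.im := by simp

/-- The chart point lies in the forward tube for `θ` in the strip and shifts `ε ≤ (r/2)e^{−|Im θ|}`. -/
theorem chartPt_mem_fwdTube {r : ℝ} (hr : 0 < r) {j : ℤ} {ε : ℝ} {θ : ℂ} (hθ : θ ∈ strip j)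
    (hε : ε ≤ r / 2 * Real.exp (-|θ.im|)) : chartPt r j ε θ ∈ fwdTube := by
  have hc := half_lt_cos_of_mem_strip hθ
  refine chart_mem_fwdTube _ ?_ ?_
  · rw [re_angle]; nlinarith
  · rw [re_angle, im_angle]
    calc ε ≤ r / 2 * Real.exp (-|θ.im|) := hε
      _ < r * Real.cos (θ.re - j * (π / 3)) * Real.exp (-|θ.im|) :=
          mul_lt_mul_of_pos_right (by nlinarith) (Real.exp_pos _)

/-- The majorant point of the chart: `ε + (Re ζ − |Im β|) = r cos(Re θ − jπ/3) e^{−|Im θ|}`. -/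
theorem chartPt_majorant {r : ℝ} (hr : 0 < r) {j : ℤ} (ε : ℝ) {θ : ℂ} (hθ : θ ∈ strip j) :
    ε + ((chartPt r j ε θ).1.re - |(chartPt r j ε θ).2.im|) = r * Real.cos (θ.re - j * (π / 3)) * Real.exp (-|θ.im|) := by
  have hc := half_lt_cos_of_mem_strip hθ
  unfold chartPt
  rw [chart_re_sub_abs_im _ (by rw [re_angle]; nlinarith), re_angle, im_angle]
  ring

/-- Changing the shift moves the first coordinate of the chart point. -/
theorem chartPt_shift (r : ℝ) (j : ℤ) (ε ε' : ℝ) (θ : ℂ) :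
    ((chartPt r j ε θ).1 + ((ε - ε' : ℝ) : ℂ), (chartPt r j ε θ).2) = chartPt r j ε' θ := by
  unfold chartPt
  ext
  · push_cast; ring
  · rfl

/-- The chart point at a real angle. -/
theorem chartPt_ofReal (r : ℝ) (j : ℤ) (ε t : ℝ) :
    chartPt r j ε t = (((r * Real.cos (t - j * (π / 3)) - ε : ℝ) : ℂ), ((r * Real.sin (t - j * (π / 3)) : ℝ) : ℂ)) := by
  unfold chartPt
  ext
  · push_cast; ring_nf
  · push_cast; ring_nf

/-- The running shift `ε(θ) = (r/4) e^{−|Im θ|}`. -/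
def shift (r : ℝ) (θ : ℂ) : ℝ := r / 4 * Real.exp (-|θ.im|)

/-- The running shift is positive. -/
theorem shift_pos {r : ℝ} (hr : 0 < r) (θ : ℂ) : 0 < shift r θ := by unfold shift; positivity

/-- The running shift is at most `(r/2)e^{−|Im θ|}`. -/
theorem shift_le_half {r : ℝ} (hr : 0 < r) (θ : ℂ) : shift r θ ≤ r / 2 * Real.exp (-|θ.im|) := by
  unfold shift; nlinarith [Real.exp_pos (-|θ.im|)]

/-- The running shift at a real angle is `r/4`. -/
theorem shift_ofReal (r t : ℝ) : shift r t = r / 4 := by simp [shift]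

/-- `e^{−|ψ₀|}/4 < e^{−|ψ|}` when `|ψ − ψ₀| < 1` (`e > 4^{…}`: we use `exp 1 < 4`, hence `e^{-1} > 1/4`). -/
theorem exp_quarter_lt {ψ ψ₀ : ℝ} (h : |ψ - ψ₀| < 1) : Real.exp (-|ψ₀|) / 4 < Real.exp (-|ψ|) := by
  have h1 : -|ψ₀| - 1 < -|ψ| := by
    have := abs_sub_abs_le_abs_sub ψ ψ₀
    linarith
  have h2 : Real.exp (-|ψ₀| - 1) < Real.exp (-|ψ|) := Real.exp_lt_exp.2 h1
  have h3 : Real.exp (-|ψ₀|) / 4 < Real.exp (-|ψ₀| - 1) := by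
    have he : Real.exp 1 < 4 := by
      have := Real.exp_one_lt_d9; linarith
    have hpos : 0 < Real.exp 1 := Real.exp_pos 1
    have h4 : (4 : ℝ)⁻¹ < Real.exp (-1) := by
      rw [Real.exp_neg]; exact (inv_lt_inv₀ (by norm_num) hpos).2 he
    rw [div_eq_mul_inv, sub_eq_add_neg, Real.exp_add]
    exact mul_lt_mul_of_pos_left h4 (Real.exp_pos _)
  linarith

end AngularChartA

end Summit.QuantumFields.YangMills.Cruxes.ShortRootRigidity.AngularType

end
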